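import Summits.QuantumFields.YangMills.Theorems.SwapVirialDeficitSectorLaplaceTrFibredLaw
import Summits.QuantumFields.YangMills.Theorems.SwapVirialDeficitSectorLaplaceBTubeMainTerm
import HarnessLib

/-!
# STUB (S-001-good) OF SKELETON ➎: THE 001 MAIN TERM — law for explicit socket data, determinant window, integrable positive main density carried by ONE operator family
# (free-hands support of ⟨stmt-QuantumFields-24197⟩ `SwapVirialDeficit.SwapGluedStiffness`; cell ym-idea-1; twin of w2 g59's ✓`…BTubeMainTerm` for the 001 chart with base `S = univ`;
# assembler fcl-p3 g48)

✓`tr_fibred_law` hides its operators behind an `∃`; the log-law ∕ stiffness step (✓`twoSided_logLaw_of_relative`, ✓`stiffness_of_twoSided_logLaplace_finite`) needs MORE about the SAME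
operators: the measurable form, the UNIFORM ceiling `⟪A u y,y⟫ ≤ 39984L⁴‖y‖²` (K7g jets, so `det A u ≤ (39984L⁴)^m` and the main term has a FLOOR) and the integrability of
`u ↦ w₀(u)∕√det(A u)` on `ℝ²`.  This file:
* §1 ★ `tr_law_of_socketData` — the √b law of ✓`tr_fibred_law` for EXPLICIT socket data `A, ρ′, e′` (the hypotheses of ✓`trFibre_rescaled_sockets`);
* §2 ★★★ `tr_mainTerm_package (ε) (hz) (hF)` — ONE operator family `A` with: symmetric; measurable form; ray identity; `λ₁‖y‖² ≤ ⟪A u y,y⟫` (`λ₁ = (5408(1+|Fol L|)L⁶)⁻¹`);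
  `⟪A u y,y⟫ ≤ 39984L⁴‖y‖²`; `λ₁^{m} ≤ det A u ≤ (39984L⁴)^{m}` for EVERY `u`; `Integrable (u ↦ (1+u₁²)⁻¹(1+u₂²)⁻¹∕√det A u)`; and the √b law for this `A`.

HONEST LABEL: the stiffness step, the reading on `chartMeasure L`, the thresholds and `stub_h001_good` remain OPEN, as do (S-core-tip), (S-end-G), ⟨24197⟩ ∕ ⟨24194⟩; item of
record ⟨24085⟩ SubOctaveBounded aside ∕ untouched; the Yang–Mills mass gap is NOT proved; no summit is proved by a line.  THEOREMS ONLY (0 `def`, 0 `sorry`), standard axioms, no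
instances.  Seat ym-line-fcl-p3 g48 (cell ym-idea-1, free hands), `--supports stmt-QuantumFields-24197`.  References: [cite: Luscher1983, §2];
[cite: HasenpflugRudolfSprungk2024, App. 4.1 Thm 16]; [cite: Breitung1994, Lemma 26 (2.102), p. 30]; [folklore].
-/

set_option autoImplicit false
set_option synthInstance.maxSize 1024

noncomputable section

open MeasureTheory Quaternion Set Metric Module
open scoped BigOperators Quaternion InnerProductSpace ENNReal
open Literature.MathematicalPhysics.QuantumFieldTheory hiding SU2
open Literature.MathematicalPhysics.QuantumLattice

namespace Summit.QuantumFields.YangMills.Theorems.SwapVirialDeficit.BlowUpRing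

open Summit.QuantumFields.YangMills.Theorems.FemtoTransferGap
open Summit.QuantumFields.YangMills.Theorems.FemtoTransferGap.TT
open Summit.QuantumFields.YangMills.Theorems.VirialFluxGap.RingDeficit
open Summit.QuantumFields.YangMills.Theorems.SwapVirialDeficit.SwapRing
open Summit.QuantumFields.YangMills.Theorems.SwapVirialDeficit.Gnomonic (normSq3 normSq3_nonneg gnomonicWeight gnomonicWeight_pos)
open Summit.QuantumFields.YangMills.Theorems.QuantitativeLaplace (laplaceMethod_quantitative_fibred_chart_cubic_offBound_on integral_gaussian_fibred)
open Summit.QuantumFields.YangMills.Theorems.SwapVirialDeficit.SectorLaplace (z₁ uJ sectorChar)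

variable {L : ℕ} [NeZero L]

/-! ## §1 The 001 law for explicit socket data -/

set_option maxHeartbeats 800000 in
/-- ★ **THE 001 √b LAW FROM EXPLICIT SOCKET DATA**: the conclusion of ✓`tr_fibred_law` for a GIVEN operator family `A` with the socket properties of
✓`trFibre_rescaled_sockets` (symmetric, measurable form, `λ₁`-coercive for every `u`, cubic identity with datum `ρ′`, `|ρ′| ≤ 1136016L⁴‖y‖³`, amplitude `w₀(u)(1+e′)`,
`|e′| ≤ 2R‖y‖`) — so that the SAME `A` carries the law and the main-term facts. [cite: Luscher1983, §2] [cite: HasenpflugRudolfSprungk2024, App. 4.1 Thm 16] -/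
theorem tr_law_of_socketData (ε : GnoSign L) {A : ℝ × ℝ → GnoFibreB L →ₗ[ℝ] GnoFibreB L} {ρ e : (ℝ × ℝ) × GnoFibreB L → ℝ}
    (hAs : ∀ u, (A u).IsSymmetric) (hAm : Measurable fun q : (ℝ × ℝ) × GnoFibreB L => ⟪A q.1 q.2, q.2⟫_ℝ) (hρm : Measurable ρ) (hem : Measurable e)
    (hcoer : ∀ u (y : GnoFibreB L), (5408 * (1 + (Fintype.card (Fol L) : ℝ)) * (L : ℝ) ^ 6)⁻¹ * ‖y‖ ^ 2 ≤ ⟪A u y, y⟫_ℝ)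
    (hf : ∀ u (y : GnoFibreB L),
      trGnoDeficit uJ z₁ (sectorChar z₁) (hubAt (gnoFibreTrEquiv (u, gnoScaleTr u y)).1 1) ε (gnoFibreTrEquiv (u, gnoScaleTr u y)).2 - 0 =
        (1 / 2) * ⟪A u y, y⟫_ℝ + ρ (u, y))
    (hρb : ∀ u (y : GnoFibreB L), |ρ (u, y)| ≤ 1136016 * (L : ℝ) ^ 4 * ‖y‖ ^ 3)
    (hw : ∀ u (y : GnoFibreB L), (∏ i, |gnoFibreTrScale (L := L) u i|) *
        (((1 + (gnoFibreTrEquiv (u, gnoScaleTr u y)).1 ^ 2)⁻¹) ^ 2 * gnoDensity (gnoFibreTrEquiv (u, gnoScaleTr u y)).2) * 1 =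
      (1 + u.1 ^ 2)⁻¹ * (1 + u.2 ^ 2)⁻¹ * (1 + e (u, y)))
    (heb : ∀ R : ℝ, 0 ≤ R → ∀ u (y : GnoFibreB L), ‖y‖ ≤ R → |e (u, y)| ≤ (2 * R) * ‖y‖)
    {R b : ℝ} (hR : 0 < R) (hR1 : R ≤ 1) (hb : 0 < b)
    (hsmall : 1136016 * (L : ℝ) ^ 4 * R ≤ (5408 * (1 + (Fintype.card (Fol L) : ℝ)) * (L : ℝ) ^ 6)⁻¹ / (8 * ((finrank ℝ (GnoFibreB L) : ℝ) + 8))) (hDR : 2 * R * R ≤ 1) :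
    |(∫ p, Real.exp (-(b * trGnoDeficit uJ z₁ (sectorChar z₁) (hubAt p.1 1) ε p.2))
          ∂((volume : Measure (ℝ × GnoCoord L)).withDensity fun p => ENNReal.ofReal (((1 + p.1 ^ 2)⁻¹) ^ 2 * gnoDensity p.2))) -
        (2 * Real.pi / b) ^ ((finrank ℝ (GnoFibreB L) : ℝ) / 2) *
          ∫ u in (univ : Set (ℝ × ℝ)), (1 + u.1 ^ 2)⁻¹ * (1 + u.2 ^ 2)⁻¹ / Real.sqrt (LinearMap.det (A u))| ≤
      ((16 * (1136016 * (L : ℝ) ^ 4) * ((finrank ℝ (GnoFibreB L) : ℝ) + 8) / (5408 * (1 + (Fintype.card (Fol L) : ℝ)) * (L : ℝ) ^ 6)⁻¹ +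
              256 * (1136016 * (L : ℝ) ^ 4) * ((finrank ℝ (GnoFibreB L) : ℝ) + 8) ^ 2 / ((5408 * (1 + (Fintype.card (Fol L) : ℝ)) * (L : ℝ) ^ 6)⁻¹) ^ 2 + 2 * R +
              8 * (2 * R) * ((finrank ℝ (GnoFibreB L) : ℝ) + 8) / (5408 * (1 + (Fintype.card (Fol L) : ℝ)) * (L : ℝ) ^ 6)⁻¹) / Real.sqrt b +
          16 * ((finrank ℝ (GnoFibreB L) : ℝ) + 8) / ((5408 * (1 + (Fintype.card (Fol L) : ℝ)) * (L : ℝ) ^ 6)⁻¹ * R ^ 2) / b) *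
        ((2 * Real.pi / b) ^ ((finrank ℝ (GnoFibreB L) : ℝ) / 2) *
          ∫ u in (univ : Set (ℝ × ℝ)), (1 + u.1 ^ 2)⁻¹ * (1 + u.2 ^ 2)⁻¹ / Real.sqrt (LinearMap.det (A u))) +
      Real.exp (-(b * (R ^ 2 / (10816 * (1 + (Fintype.card (Fol L) : ℝ)) * (L : ℝ) ^ 6)))) *
        ((volume : Measure (ℝ × GnoCoord L)).withDensity fun p => ENNReal.ofReal (((1 + p.1 ^ 2)⁻¹) ^ 2 * gnoDensity p.2)).real univ := by
  have hL : (0 : ℝ) < (L : ℝ) := by exact_mod_cast NeZero.pos L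
  set lam : ℝ := (5408 * (1 + (Fintype.card (Fol L) : ℝ)) * (L : ℝ) ^ 6)⁻¹ with hlam
  have hlam0 : 0 < lam := by positivity
  -- the measure space and the letters
  set μB : Measure (ℝ × GnoCoord L) := (volume : Measure (ℝ × GnoCoord L)).withDensity fun p => ENNReal.ofReal (((1 + p.1 ^ 2)⁻¹) ^ 2 * gnoDensity p.2) with hμB
  haveI : IsFiniteMeasure μB := isFiniteMeasure_muB
  set f : ℝ × GnoCoord L → ℝ := fun p => trGnoDeficit uJ z₁ (sectorChar z₁) (hubAt p.1 1) ε p.2 with hfdef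
  have hfm : Measurable f := (contDiff_trDeficit (n := 0) ε).continuous.measurable
  set Ψ' : (ℝ × ℝ) × GnoFibreB L → ℝ × GnoCoord L := fun q => gnoFibreTrEquiv (q.1, gnoScaleTr q.1 q.2) with hΨ'
  obtain ⟨hTm, hchart⟩ := volume_muB_restrict_scaledTrTube_eq_map (L := L) MeasurableSet.univ R
  have hΨm : Measurable Ψ' := measurable_trScaledChart (L := L)
  have hJm : Measurable fun q : (ℝ × ℝ) × GnoFibreB L =>
      (∏ i, |gnoFibreTrScale (L := L) q.1 i|) * (((1 + (gnoFibreTrEquiv (q.1, gnoScaleTr q.1 q.2)).1 ^ 2)⁻¹) ^ 2 * gnoDensity (gnoFibreTrEquiv (q.1, gnoScaleTr q.1 q.2)).2) :=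
    (Finset.measurable_prod _ fun i _ => ((measurable_gnoFibreTrScale i).comp measurable_fst).abs).mul (measurable_bDensity.comp (measurable_trScaledChart (L := L)))
  have hJ0 : ∀ q ∈ (univ : Set (ℝ × ℝ)) ×ˢ closedBall (0 : GnoFibreB L) R,
      0 ≤ (∏ i, |gnoFibreTrScale (L := L) q.1 i|) * (((1 + (gnoFibreTrEquiv (q.1, gnoScaleTr q.1 q.2)).1 ^ 2)⁻¹) ^ 2 * gnoDensity (gnoFibreTrEquiv (q.1, gnoScaleTr q.1 q.2)).2) :=
    fun q _ => mul_nonneg (Finset.prod_nonneg fun i _ => abs_nonneg _) (bDensity_pos _).le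
  obtain ⟨-, hw0pos, hw0m, hw0i⟩ := trBaseWeight_facts
  -- the off-tube bound from the far floor
  have hoff : ∀ x, x ∉ Ψ' '' ((univ : Set (ℝ × ℝ)) ×ˢ closedBall (0 : GnoFibreB L) R) →
      ‖Real.exp (-(b * (f x - 0))) * (1 : ℝ)‖ ≤ Real.exp (-(b * (R ^ 2 / (10816 * (1 + (Fintype.card (Fol L) : ℝ)) * (L : ℝ) ^ 6)))) := by
    intro x hxT
    obtain ⟨u, y, hRy, rfl⟩ := exists_of_not_mem_scaledTrTube (L := L) hxT
    have hfar := tr001_hfar_rescaled (L := L) ε u y hR.le hR1 hRy.le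
    rw [mul_one, sub_zero, Real.norm_eq_abs, abs_of_pos (Real.exp_pos _), Real.exp_le_exp, neg_le_neg_iff]
    exact mul_le_mul_of_nonneg_left hfar hb.le
  -- apply the generic law with `S = univ`, `φ = 1`
  obtain ⟨-, hbd⟩ := laplaceMethod_quantitative_fibred_chart_cubic_offBound_on (X := ℝ × GnoCoord L) (μ := μB) (M := ℝ × ℝ) (ν := volume) (V := GnoFibreB L)
    (Ψ := Ψ') (J := fun q => (∏ i, |gnoFibreTrScale (L := L) q.1 i|) *
      (((1 + (gnoFibreTrEquiv (q.1, gnoScaleTr q.1 q.2)).1 ^ 2)⁻¹) ^ 2 * gnoDensity (gnoFibreTrEquiv (q.1, gnoScaleTr q.1 q.2)).2)) (f := f) (φ := fun _ => (1 : ℝ)) (f₀ := 0)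
    MeasurableSet.univ (mem_univ ((0 : ℝ), (0 : ℝ))) (A := A) (fun u _ => hAs u) hlam0 (fun u _ y => hcoer u y) hAm (R := R) (A₃ := 1136016 * (L : ℝ) ^ 4)
    (D := 2 * R) (β := b) (Eoff := Real.exp (-(b * (R ^ 2 / (10816 * (1 + (Fintype.card (Fol L) : ℝ)) * (L : ℝ) ^ 6)))))
    hR (by positivity) (by positivity) hb hsmall hDR hΨm hTm hJm hJ0 hchart hfm measurable_const hρm hem hw0m (fun u _ => (hw0pos u).le) hw0i.integrableOn
    (fun u _ y _ => hρb u y) (fun u _ y hy => heb R hR.le u y hy) (fun u _ y _ => hf u y) (fun u _ y _ => hw u y) (by positivity) (Filter.Eventually.of_forall hoff)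
  have hlhs : ∫ x, Real.exp (-(b * (f x - 0))) * (1 : ℝ) ∂μB = ∫ p, Real.exp (-(b * f p)) ∂μB := by
    refine integral_congr_ae (Filter.Eventually.of_forall fun x => ?_)
    show Real.exp (-(b * (f x - 0))) * 1 = Real.exp (-(b * f x))
    rw [sub_zero, mul_one]
  rw [hlhs] at hbd
  exact hbd

/-! ## §2 The 001 main-term package -/

/-- ★★★ **THE 001 MAIN-TERM PACKAGE** (good sign patterns): ONE operator family `A` on `V_B` with — symmetric; measurable form; the ray identity; `λ₁`-coercivity for EVERY
`u ∈ ℝ²` (`λ₁ = (5408(1+|Fol L|)L⁶)⁻¹`); the UNIFORM ceiling `⟪A u y,y⟫ ≤ 39984L⁴‖y‖²` (K7g); the determinant window `λ₁^{m} ≤ det A u ≤ (39984L⁴)^{m}`;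
`Integrable (u ↦ (1+u₁²)⁻¹(1+u₂²)⁻¹∕√det A u)`; and the √b law for THIS `A`. [cite: Luscher1983, §2] [cite: HasenpflugRudolfSprungk2024, App. 4.1 Thm 16]
[cite: Breitung1994, Lemma 26 (2.102), p. 30] -/
theorem tr_mainTerm_package (ε : GnoSign L) (hz : ε.2.1 = true) (hF : ε.2.2 = fun _ => true) :
    ∃ A : ℝ × ℝ → GnoFibreB L →ₗ[ℝ] GnoFibreB L,
      (∀ u, (A u).IsSymmetric) ∧
      (Measurable fun q : (ℝ × ℝ) × GnoFibreB L => ⟪A q.1 q.2, q.2⟫_ℝ) ∧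
      (∀ u (y : GnoFibreB L), ⟪A u y, y⟫_ℝ =
        iteratedDeriv 2 (fun s : ℝ =>
          trGnoDeficit uJ z₁ (sectorChar z₁) (hubAt (gnoFibreTrEquiv (u, gnoScaleTr u (s • y))).1 1) ε (gnoFibreTrEquiv (u, gnoScaleTr u (s • y))).2) 0) ∧
      (∀ u (y : GnoFibreB L), (5408 * (1 + (Fintype.card (Fol L) : ℝ)) * (L : ℝ) ^ 6)⁻¹ * ‖y‖ ^ 2 ≤ ⟪A u y, y⟫_ℝ) ∧
      (∀ u (y : GnoFibreB L), ⟪A u y, y⟫_ℝ ≤ 39984 * (L : ℝ) ^ 4 * ‖y‖ ^ 2) ∧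
      (∀ u, ((5408 * (1 + (Fintype.card (Fol L) : ℝ)) * (L : ℝ) ^ 6)⁻¹) ^ finrank ℝ (GnoFibreB L) ≤ LinearMap.det (A u) ∧
        LinearMap.det (A u) ≤ (39984 * (L : ℝ) ^ 4) ^ finrank ℝ (GnoFibreB L)) ∧
      Integrable (fun u : ℝ × ℝ => (1 + u.1 ^ 2)⁻¹ * (1 + u.2 ^ 2)⁻¹ / Real.sqrt (LinearMap.det (A u))) ∧
      ∀ {R b : ℝ}, 0 < R → R ≤ 1 → 0 < b →
        1136016 * (L : ℝ) ^ 4 * R ≤ (5408 * (1 + (Fintype.card (Fol L) : ℝ)) * (L : ℝ) ^ 6)⁻¹ / (8 * ((finrank ℝ (GnoFibreB L) : ℝ) + 8)) → 2 * R * R ≤ 1 →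
        |(∫ p, Real.exp (-(b * trGnoDeficit uJ z₁ (sectorChar z₁) (hubAt p.1 1) ε p.2))
              ∂((volume : Measure (ℝ × GnoCoord L)).withDensity fun p => ENNReal.ofReal (((1 + p.1 ^ 2)⁻¹) ^ 2 * gnoDensity p.2))) -
            (2 * Real.pi / b) ^ ((finrank ℝ (GnoFibreB L) : ℝ) / 2) *
              ∫ u in (univ : Set (ℝ × ℝ)), (1 + u.1 ^ 2)⁻¹ * (1 + u.2 ^ 2)⁻¹ / Real.sqrt (LinearMap.det (A u))| ≤
          ((16 * (1136016 * (L : ℝ) ^ 4) * ((finrank ℝ (GnoFibreB L) : ℝ) + 8) / (5408 * (1 + (Fintype.card (Fol L) : ℝ)) * (L : ℝ) ^ 6)⁻¹ +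
                  256 * (1136016 * (L : ℝ) ^ 4) * ((finrank ℝ (GnoFibreB L) : ℝ) + 8) ^ 2 / ((5408 * (1 + (Fintype.card (Fol L) : ℝ)) * (L : ℝ) ^ 6)⁻¹) ^ 2 + 2 * R +
                  8 * (2 * R) * ((finrank ℝ (GnoFibreB L) : ℝ) + 8) / (5408 * (1 + (Fintype.card (Fol L) : ℝ)) * (L : ℝ) ^ 6)⁻¹) / Real.sqrt b +
              16 * ((finrank ℝ (GnoFibreB L) : ℝ) + 8) / ((5408 * (1 + (Fintype.card (Fol L) : ℝ)) * (L : ℝ) ^ 6)⁻¹ * R ^ 2) / b) *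
            ((2 * Real.pi / b) ^ ((finrank ℝ (GnoFibreB L) : ℝ) / 2) *
              ∫ u in (univ : Set (ℝ × ℝ)), (1 + u.1 ^ 2)⁻¹ * (1 + u.2 ^ 2)⁻¹ / Real.sqrt (LinearMap.det (A u))) +
          Real.exp (-(b * (R ^ 2 / (10816 * (1 + (Fintype.card (Fol L) : ℝ)) * (L : ℝ) ^ 6)))) *
            ((volume : Measure (ℝ × GnoCoord L)).withDensity fun p => ENNReal.ofReal (((1 + p.1 ^ 2)⁻¹) ^ 2 * gnoDensity p.2)).real univ := by
  obtain ⟨A, ρ, e, hAs, hAm, hρm, hem, hray, hcoer, hf, hρb, hw, heb⟩ := trFibre_rescaled_sockets (L := L) ε hz hF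
  have hL : (0 : ℝ) < (L : ℝ) := by exact_mod_cast NeZero.pos L
  set lam : ℝ := (5408 * (1 + (Fintype.card (Fol L) : ℝ)) * (L : ℝ) ^ 6)⁻¹ with hlam
  have hlam0 : 0 < lam := by positivity
  -- the uniform ceiling (K7g line jets at the base, via the ray identity)
  have hup : ∀ u (y : GnoFibreB L), ⟪A u y, y⟫_ℝ ≤ 39984 * (L : ℝ) ^ 4 * ‖y‖ ^ 2 := by
    intro u y
    rw [hray]
    have e0 : (fun s : ℝ => trGnoDeficit uJ z₁ (sectorChar z₁) (hubAt (gnoFibreTrEquiv (u, gnoScaleTr u (s • y))).1 1) ε (gnoFibreTrEquiv (u, gnoScaleTr u (s • y))).2) =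
        fun s : ℝ => trGnoDeficit uJ z₁ (sectorChar z₁) (hubAt (gnoFibreTrEquiv (u, gnoScaleTr u ((0 : GnoFibreB L) + s • y))).1 1) ε
          (gnoFibreTrEquiv (u, gnoScaleTr u ((0 : GnoFibreB L) + s • y))).2 := by
      funext s; rw [zero_add]
    rw [e0, trFibre_rescaled_ray]
    exact le_trans (le_abs_self _) ((trFibre_rescaled_lineJets ε u 0 y).1 0).2.1
  have hdet : ∀ u : ℝ × ℝ, lam ^ finrank ℝ (GnoFibreB L) ≤ LinearMap.det (A u) ∧ LinearMap.det (A u) ≤ (39984 * (L : ℝ) ^ 4) ^ finrank ℝ (GnoFibreB L) := fun u =>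
    ⟨det_ge_pow_of_coercive (hAs u) hlam0 (hcoer u), det_le_pow_of_inner_le (hAs u) hlam0 (hcoer u) (hup u)⟩
  -- integrability of the main density on `ℝ²`
  obtain ⟨-, hw0pos, hw0m, hw0i⟩ := trBaseWeight_facts
  obtain ⟨-, hI, -⟩ := integral_gaussian_fibred (ν := (volume : Measure (ℝ × ℝ))) (A := A) hAs hlam0 hcoer hAm hw0m (fun u => (hw0pos u).le) hw0i one_pos
  have hint : Integrable (fun u : ℝ × ℝ => (1 + u.1 ^ 2)⁻¹ * (1 + u.2 ^ 2)⁻¹ / Real.sqrt (LinearMap.det (A u))) := by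
    have hc : (0 : ℝ) < (2 * Real.pi / 1) ^ ((finrank ℝ (GnoFibreB L) : ℝ) / 2) := Real.rpow_pos_of_pos (by positivity) _
    have h2 := hI.div_const ((2 * Real.pi / 1) ^ ((finrank ℝ (GnoFibreB L) : ℝ) / 2))
    refine (integrable_congr (Filter.Eventually.of_forall fun u => ?_)).1 h2
    show (1 + u.1 ^ 2)⁻¹ * (1 + u.2 ^ 2)⁻¹ * ((2 * Real.pi / 1) ^ ((finrank ℝ (GnoFibreB L) : ℝ) / 2) / Real.sqrt (LinearMap.det (A u))) /
        (2 * Real.pi / 1) ^ ((finrank ℝ (GnoFibreB L) : ℝ) / 2) = (1 + u.1 ^ 2)⁻¹ * (1 + u.2 ^ 2)⁻¹ / Real.sqrt (LinearMap.det (A u))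
    field_simp
  refine ⟨A, hAs, hAm, hray, hcoer, hup, hdet, hint, ?_⟩
  intro R b hR hR1 hb hsmall hDR
  exact tr_law_of_socketData ε hAs hAm hρm hem hcoer hf hρb hw heb hR hR1 hb hsmall hDR

end Summit.QuantumFields.YangMills.Theorems.SwapVirialDeficit.BlowUpRing

end
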